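import Literature.InformationTheory.QuantumCodes.StabilizerErasureCapacity
import HarnessLib

/-!
# Delfosse–Zémor: bounded-weight (LDPC) stabilizer codes do not achieve the capacity of the quantum erasure
# channel — `R ≤ 1 − 2p − D(p)` and `R ≤ (1−2p)(1−(1−p)^{m−1})/(1−(1−2p)(1−p)^{m−1})`

Topic `Literature/InformationTheory/QuantumCodes` (venture QEC, LADDER-QEC rung Q5: a certified CEILING on erasure thresholds
of every bounded-check-weight stabilizer family, sharper than the no-cloning value `(1 − R)/2`; qec-lit-2 gen 7).
Theorem-only: no definition, no named fact, no `sorry`, kernel axioms.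

**Printed statements** (Delfosse–Zémor, *Upper bounds on the rate of low density stabilizer codes for the quantum
erasure channel*, QIC 13 (2013) 793 = arXiv:1205.7036).
* §3.1: each qubit is erased independently with probability `p`, `ℙ(ℰ) = p^{|ℰ|}(1−p)^{n−|ℰ|}`; "when the erasure
  vector covers a problematic error, we will say that we have a non-correctable erasure".
* §3.3, Lemma 3.2: `N(S)_ℰ = {E ∈ N(S) | E ⊂ ℰ}` is an `𝔽₂`-space of dimension `2|ℰ| − rank H_ℰ`; Lemma 3.3:
  `S_ℰ = {s ∈ S | s ⊂ ℰ}` has dimension `rank H − rank H_{ℰ̄}`; hence "the erasure vector `ℰ` can be corrected only if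
  `2|ℰ| ≤ rank H + rank H_ℰ − rank H_{ℰ̄}`".
* §3.4, Definition 3.4: the rank difference function `D(p) = limsup_t Δ_t(p)`,
  `Δ_t(p) = 𝔼_p[rank H_{t,ℰ̄} − rank H_{t,ℰ}]/n_t`. **Theorem 3.5**: achievable rates of a sequence of stabilizer codes
  over the quantum erasure channel of probability `p` satisfy `R ≤ 1 − 2p − D(p)`. Corollary 3.7: `R ≤ 1 − 2p`
  (`p ≤ 1/2`).
* §3.5, **Theorem 3.8**: "Let `𝒞` be any family of stabilizer codes of rates at least `R` and achieving vanishing decoding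
  error probability over the quantum erasure channel of erasure probability `p`. Suppose furthermore that every code
  `C ∈ 𝒞` has a set of generators of its stabilizer group whose weights are all upper bounded by `m`. Then
  `R ≤ (1−2p)·(1−(1−p)^{m−1}) / (1−(1−2p)(1−p)^{m−1})`." Method: eq. (fconcave)
  `Δ(p) ≥ ((1−2p)/(1−p))·(rank H/n − M(p))` for any bound `φ(p) ≤ M(p)`, `φ(p) = 𝔼_p(rank H_ℰ)/n`; proof:
  `φ(p) ≤ rank H/n − (rank H/n)(1−p)^m` (zero rows of `H_ℰ`).
* Appendix §8: Lemma 8.1 (the rank of `H_A` is a submodular function of `A`), Lemma 8.2, Prop. 8.3 (`φ` increasing),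
  Prop. 8.4 (`φ` concave), Prop. 8.5 (the chord inequality `φ(1−p) ≥ φ(p) + (1−2p)(φ(1) − φ(p))/(1−p)`).

**Model** (the tree's, nothing new). A stabilizer space is a subspace `S̄ ≤ 𝔽₂ⁿ × 𝔽₂ⁿ` (`SympVec n`); `P(M)`
(`supportedOn M`) are the vectors supported on `M ⊆ Fin n`; the erasure `M` is non-correctable iff a logical operator
lives inside it, `¬ IsCorrectableRegion S̄ M` (`CorrectableRegions.lean`; DZ13 §3.1), and the failure probability at
erasure rate `p` is `eventProb (fun M => ¬ IsCorrectableRegion S̄ M) p = Σ_M p^{|M|}(1−p)^{n−|M|}·𝟙[M non-correctable]`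
(`CodeCapacityNoise.lean`), written inline. The printed `S_ℰ` is `S̄ ⊓ P(M)`; we write
`κ(M) = dim (S̄ ⊓ P(M))` and `K(p) = Σ_M p^{|M|}(1−p)^{n−|M|} κ(M)` (inline sums, no definition). By Lemma 3.3,
`rank H_M = dim S̄ − κ(Mᶜ)` (`finrank_map_proj_add_finrank_inf_supportedOn`), so the printed `φ(p) = (dim S̄ − K(1−p))/n`
and `n·Δ(p) = K(1−p) − K(p)`: every statement below is the printed one in the `κ`-coordinates.

**Results** (all PROVED here; `s = dim S̄ = n − k`).
* Lemma 3.3 (`finrank_map_proj_add_finrank_inf_supportedOn`): `rank H_{Mᶜ} + κ(M) = dim S̄`. Lemma 3.2 is used in the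
  inequality form `2|M| + κ(Mᶜ) ≤ dim(S̄⊥ ⊓ P(M)) + dim S̄` already in the tree (`finrank_sympDual_inf_supportedOn_ge`);
  its EXACT form `dim(S̄⊥ ⊓ P(M)) + rank H_M = 2|M|` (`finrank_sympDual_inf_supportedOn_add_finrank_map_proj`, from the
  tree's exact cleaning count `finrank_sympDual_inf_supportedOn_add`) and the printed correctability criterion as an equivalence for self-orthogonal `S̄`
  (`isCorrectableRegion_iff_rank`: `M` correctable ↔ `2|M| + rank H_{Mᶜ} = rank H + rank H_M`; the printed "only if
  `2|ℰ| ≤ rank H + rank H_ℰ − rank H_ℰ̄`" for every subspace: `two_mul_card_add_le_of_isCorrectableRegion`) are appended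
  (section `ExactCount`).
* THE COUNT, pointwise (`erasure_count_le_indicator`): `2|M| + κ(Mᶜ) − s − κ(M) ≤ 2n·𝟙[M non-correctable]` — the
  printed "`ℰ` can be corrected only if `2|ℰ| ≤ rank H + rank H_ℰ − rank H_ℰ̄`".
* **THEOREM 3.5, finite form** (`DelfosseZemor_rankDifference_bound`): for EVERY subspace `S̄` and `0 ≤ p ≤ 1`,
  `2pn − s + (K(1−p) − K(p)) ≤ 2n·P_p[non-correctable]`, i.e. `k ≤ n(1 − 2p) + 2n·P_p − n·Δ(p)`
  (`k_le_of_rankDifference`). Fano's inequality of the printed proof is replaced by the indicator bound (the optimal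
  decoder fails with conditional probability `1 − 2^{−h(M)} ≥ ½·𝟙[h(M) ≥ 1]`, so the printed `P_err` and the tree's
  `P[non-correctable]` have the same threshold); no self-orthogonality is used.
* Lemma 8.1 in `κ`-form (`finrank_inf_supportedOn_superModular`): `κ(X) + κ(Y) ≤ κ(X ∪ Y) + κ(X ∩ Y)`; increasing
  marginals (`finrank_inf_supportedOn_inter_marginal_le`).
* Props. 8.4/8.5 WITHOUT calculus: a telescoping chord inequality for set functions with increasing marginals
  (`sum_prefix_telescope`, `sub_le_sum_prefix_of_marginal_le`, `sum_bernoulliWeight_mul_le_of_marginal_le`: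
  `𝔼_θ f(G) ≤ f(∅) + θ·(f(univ) − f(∅))`), the thinning law `Ber(q) ∩ Ber(θ) = Ber(qθ)`
  (`sum_bernoulliWeight_mul_sum_inter`), hence `K(qθ) ≤ θ·K(q)` (`supportedDim_thinning_le`) and Prop. 8.5 in the form
  `(1−p)·K(p) ≤ p·K(1−p)` for `p ≤ 1/2` (`supportedDim_chord`); Prop. 8.3/Cor. 3.7: `K(p) ≤ K(1−p)`.
* Generators of weight `≤ m` spanning `S̄` give `K(q) ≥ s·q^m` (`finrank_mul_pow_le_supportedDim`: a basis among the
  generators; a generator inside `M` is a stabilizer inside `M`).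
* **THEOREM 3.8, finite form** (`DelfosseZemor_boundedWeight_count`, `DelfosseZemor_boundedWeight_k_le`): for every
  subspace `S̄ ≤ 𝔽₂ⁿ × 𝔽₂ⁿ` spanned by vectors of symplectic weight `≤ m`, `dim S̄ = n − k`, and `0 ≤ p ≤ 1/2`:
  `k·(1 − (1−2p)(1−p)^{m−1}) ≤ n·(1−2p)·(1 − (1−p)^{m−1}) + 2n·P_p[non-correctable]`.
* FAMILIES of stabilizer codes with `k_i ≥ 1`, rate `≥ R` (`R n_i ≤ k_i`) and generators of weight `≤ m`: if the erasure
  rate `0 ≤ p ≤ 1/2` is below threshold then `R·(1 − (1−2p)(1−p)^{m−1}) ≤ (1−2p)(1 − (1−p)^{m−1})`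
  (`DelfosseZemor_theorem38`), the printed quotient form for `0 < p` (`DelfosseZemor_theorem38_div`), the capacity-gap
  form `(1−R)(1−2p)(1−p)^{m−1} ≤ (1 − 2p) − R` (`DelfosseZemor_capacity_gap`); for the erasure accuracy threshold `ε_c`:
  `(1−R)(1−2ε_c)(1−ε_c)^{m−1} ≤ (1 − 2ε_c) − R` (`DelfosseZemor_capacity_gap_accuracyThreshold`) and, for `0 < R < 1`,
  `ε_c < (1 − R)/2` STRICTLY (`stabilizerLDPC_erasure_accuracyThreshold_lt`) — "any family of stabilizer codes that have
  stabilizer groups with generators of weight bounded by a constant, cannot achieve the capacity of the quantum erasure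
  channel" (§1).

* CSS CODES (appended): a check-matrix CSS code whose `X`- and `Z`-rows have weight `≤ m` has its stabilizer space
  `rs H^X × rs H^Z` spanned by the weight-`≤ m` vectors `(row, 0)`, `(0, row)` (`CSSCode.exists_generators_sympWeight_le`);
  its stabilizer-level erasure failure is at most the sum of the two sector failures
  (`CSSCode.erasureFailure_toSympCode_le_add`); hence Theorem 3.8 for CSS families with both sectors below threshold at
  `p` (`CSSCode.DelfosseZemor_theorem38`, capacity-gap form `CSSCode.DelfosseZemor_capacity_gap`) and, for a common
  certified erasure threshold lower bound `a` of both sectors of a family of rate `≥ R`, `0 < R < 1`: `a < (1 − R)/2`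
  (`CSSCode.erasure_threshold_lt_half_sub_rate_of_rowWeight_le`) — §2.7/§3.1 of the paper (CSS codes as stabilizer codes,
  Prop. 3.1).

Not claimed: the refined bound of §4 for the surface codes `CSS(2,m)` and the percolation application §5–§6 (Thm. 1.1);
the entropic `P_err` form of Thm. 3.5 with Fano's `−1`; `D(p)` as a `limsup` object (the finite inequality is summed
along the family instead).

## References

* [DelfosseZemor2013] N. Delfosse, G. Zémor, QIC 13 (2013) 793 = arXiv:1205.7036: §3.1 (chunk p0007 L40–L47 erasure
  law, L62–L66 non-correctable erasure); §3.3 Lemma 3.2, Lemma 3.3, eq. (rank_equation_idea) (chunk p0008 L32–L74);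
  §3.4 Def. 3.4, Thm. 3.5 (chunk p0008 L88–L104), proof and Lemma 3.6, Cor. 3.7 (chunk p0009); §3.5 Thm. 3.8, Method
  eq. (fconcave), proof (chunk p0009 L95 – p0010 L22); App. §8 Lemma 8.1, Lemma 8.2, Props. 8.3–8.5 (chunks p0021–p0022).
* [BennettDivincenzoSmolin1997] C. H. Bennett, D. P. DiVincenzo, J. A. Smolin, PRL 78 (1997) 3217, p. 3218 (`Q = 1 − 2ε`).
* [BravyiTerhal2009] S. Bravyi, B. Terhal, NJP 11 (2009) 043029, §2 Lemma 1 (Cleaning Lemma) — the tree's cleaning count.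
* [DennisEtAl2002] E. Dennis, A. Kitaev, A. Landahl, J. Preskill, J. Math. Phys. 43 (2002) 4452, §4.3, §4.6 (threshold).

## Mathlib / tree search

Tree: `supportedOn`, `proj`, `ker_proj`, `finrank_supportedOn_le`, `finrank_sympDual_inf_supportedOn_ge`,
`mem_supportedOn_inter`, `supportedOn_mono`, `mem_supportedOn_of_forall_sympSupport`, `IsCorrectableRegion`,
`bernoulliWeight(_nonneg)`, `sum_bernoulliWeight`, `sum_bernoulliWeight_mul_card`, `sum_bernoulliWeight_filter_superset`,
`bernoulliWeight_one_sub_compl`, `sum_bernoulliWeight_mul_sum_union`, `sum_bernoulliWeight_mul_ite_eq_eventProb_not`,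
`not_belowThreshold_of_le`, `stabilizer_erasure_threshold_le_half`, `stabilizer_quantumErasure_accuracyThreshold_le_half_sub_rate`,
`isThresholdLowerBound_accuracyThreshold`, `accuracyThreshold_nonneg`. Mathlib: `Submodule.finrank_sup_add_finrank_inf_eq`,
`LinearMap.finrank_range_add_finrank_ker`, `exists_linearIndependent`, `finrank_span_set_eq_card`, `Finset.induction_on_max`,
`Finset.sum_comm'`, `Fintype.sum_bijective`, `compl_bijective`. `lean search 'rank difference|submodular|Theorem 3.8'`
in the topic: no prior formalisation (only `R ≤ 1 − 2p`, `CSSErasureCapacityConverse.lean` / `StabilizerErasureCapacity.lean`).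
-/

namespace Literature.InformationTheory.QuantumCodes

open Finset Matrix Filter Topology Module

/-! ### Bernoulli-law plumbing: reflection `M ↦ Mᶜ` and the thinning law `Ber(q) ∩ Ber(θ) = Ber(qθ)` -/

section Plumbing

variable {V : Type*} [Fintype V] [DecidableEq V]

/-- **Reflection of an expectation**: `Σ_E p^{|E|}(1−p)^{n−|E|} h(Eᶜ) = Σ_E (1−p)^{|E|}p^{n−|E|} h(E)` (the complement
of a `Ber(p)` pattern is a `Ber(1−p)` pattern). [cite: DelfosseZemor2013, §3.3 (H_ℰ̄, the non-erased positions; ℰ̄ᵢ = ℰᵢ + 1)] -/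
theorem sum_bernoulliWeight_mul_apply_compl (p : ℝ) (h : Finset V → ℝ) :
    ∑ E : Finset V, bernoulliWeight p E * h Eᶜ = ∑ E : Finset V, bernoulliWeight (1 - p) E * h E :=
  Fintype.sum_bijective compl compl_bijective _ _ fun E => by rw [bernoulliWeight_one_sub_compl]

/-- **Thinning law**: if `A ∼ Ber(q)` and `B ∼ Ber(θ)` are independent patterns then `A ∩ B ∼ Ber(qθ)`:
`Σ_A Σ_B q^{|A|}(1−q)^{n−|A|} θ^{|B|}(1−θ)^{n−|B|} g(A ∩ B) = Σ_C (qθ)^{|C|}(1−qθ)^{n−|C|} g(C)` (complement the union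
law). [cite: DelfosseZemor2013, §8 (Φ(x): the i-th component of ℰ is 1 with probability xᵢ, independently)] -/
theorem sum_bernoulliWeight_mul_sum_inter (q θ : ℝ) (g : Finset V → ℝ) :
    ∑ A : Finset V, bernoulliWeight q A * ∑ B : Finset V, bernoulliWeight θ B * g (A ∩ B) =
      ∑ C : Finset V, bernoulliWeight (q * θ) C * g C := by
  have h1 : ∀ A : Finset V, ∑ B : Finset V, bernoulliWeight θ B * g (A ∩ B) =
      ∑ B : Finset V, bernoulliWeight (1 - θ) B * g (A ∩ Bᶜ) := by
    intro A
    have h := sum_bernoulliWeight_mul_apply_compl θ (fun B => g (A ∩ Bᶜ))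
    simp only [compl_compl] at h
    exact h
  have h2 := sum_bernoulliWeight_mul_apply_compl q
    (fun A => ∑ B : Finset V, bernoulliWeight (1 - θ) B * g (Aᶜ ∩ Bᶜ))
  simp only [compl_compl] at h2
  have h3 := sum_bernoulliWeight_mul_sum_union (1 - q) (1 - θ) (fun C => g Cᶜ)
  have h4 := sum_bernoulliWeight_mul_apply_compl (1 - q * θ) g
  rw [sub_sub_cancel] at h4
  calc ∑ A : Finset V, bernoulliWeight q A * ∑ B : Finset V, bernoulliWeight θ B * g (A ∩ B)
      = ∑ A : Finset V, bernoulliWeight q A * ∑ B : Finset V, bernoulliWeight (1 - θ) B * g (A ∩ Bᶜ) := by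
        refine Finset.sum_congr rfl fun A _ => ?_
        rw [h1 A]
    _ = ∑ A : Finset V, bernoulliWeight (1 - q) A *
          ∑ B : Finset V, bernoulliWeight (1 - θ) B * g (A ∪ B)ᶜ := by
        rw [h2]
        refine Finset.sum_congr rfl fun A _ => ?_
        congr 1
        refine Finset.sum_congr rfl fun B _ => ?_
        rw [Finset.compl_union]
    _ = ∑ C : Finset V, bernoulliWeight (1 - q * θ) C * g Cᶜ := by
        rw [h3, show 1 - q + (1 - (1 - q)) * (1 - θ) = 1 - q * θ by ring]
    _ = ∑ C : Finset V, bernoulliWeight (q * θ) C * g C := h4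

end Plumbing

/-! ### Props. 8.4–8.5 without calculus: a telescoping chord inequality for increasing marginals -/

section Telescoping

variable {α : Type*} [LinearOrder α]

/-- Prefix telescoping along a linear order: `Σ_{i ∈ G} (f(G ∩ (−∞,i]) − f(G ∩ (−∞,i))) = f(G) − f(∅)`.
[cite: DelfosseZemor2013, §8 Lemma 8.2 (Φ is affine in each variable: successive one-coordinate differences)] -/
theorem sum_prefix_telescope (f : Finset α → ℝ) (G : Finset α) :
    ∑ i ∈ G, (f (G.filter (· ≤ i)) - f (G.filter (· < i))) = f G - f ∅ := by
  induction G using Finset.induction_on_max with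
  | empty => simp
  | insert a s ha ih =>
    have has : a ∉ s := fun h => lt_irrefl a (ha a h)
    rw [Finset.sum_insert has]
    have h1 : (insert a s).filter (· ≤ a) = insert a s := by
      ext x
      simp only [mem_filter, mem_insert, and_iff_left_iff_imp]
      rintro (rfl | hx)
      · exact le_rfl
      · exact (ha x hx).le
    have h2 : (insert a s).filter (· < a) = s := by
      ext x
      simp only [mem_filter, mem_insert]
      constructor
      · rintro ⟨rfl | hx, hlt⟩
        · exact absurd hlt (lt_irrefl _)
        · exact hx
      · intro hx
        exact ⟨Or.inr hx, ha x hx⟩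
    have h3 : ∀ i ∈ s, (insert a s).filter (· ≤ i) = s.filter (· ≤ i) := by
      intro i hi
      ext x
      simp only [mem_filter, mem_insert]
      constructor
      · rintro ⟨rfl | hx, hle⟩
        · exact absurd hle (not_le.2 (ha i hi))
        · exact ⟨hx, hle⟩
      · rintro ⟨hx, hle⟩
        exact ⟨Or.inr hx, hle⟩
    have h4 : ∀ i ∈ s, (insert a s).filter (· < i) = s.filter (· < i) := by
      intro i hi
      ext x
      simp only [mem_filter, mem_insert]
      constructor
      · rintro ⟨rfl | hx, hlt⟩
        · exact absurd hlt (not_lt.2 (ha i hi).le)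
        · exact ⟨hx, hlt⟩
      · rintro ⟨hx, hlt⟩
        exact ⟨Or.inr hx, hlt⟩
    rw [h1, h2, Finset.sum_congr rfl fun i hi => by rw [h3 i hi, h4 i hi], ih]
    ring

variable [Fintype α]

/-- **Increasing marginals are dominated by the full-chain marginals**: if `f(A ∪ {i}) − f(A) ≤ f(B ∪ {i}) − f(B)`
whenever `A ⊆ B ∌ i` (supermodularity), then `f(G) − f(∅) ≤ Σ_{i ∈ G} (f((−∞,i]) − f((−∞,i)))`.
[cite: DelfosseZemor2013, §8 Lemma 8.1 (submodularity) and Lemma 8.2 (sign of the second differences)] -/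
theorem sub_le_sum_prefix_of_marginal_le (f : Finset α → ℝ)
    (hf : ∀ A B : Finset α, A ⊆ B → ∀ i, i ∉ B → f (insert i A) - f A ≤ f (insert i B) - f B) (G : Finset α) :
    f G - f ∅ ≤ ∑ i ∈ G, (f (univ.filter (· ≤ i)) - f (univ.filter (· < i))) := by
  rw [← sum_prefix_telescope f G]
  refine Finset.sum_le_sum fun i hi => ?_
  have hA : G.filter (· ≤ i) = insert i (G.filter (· < i)) := by
    ext x
    simp only [mem_filter, mem_insert]
    constructor
    · rintro ⟨hx, hle⟩
      rcases hle.lt_or_eq with h | h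
      · exact Or.inr ⟨hx, h⟩
      · exact Or.inl h
    · rintro (rfl | ⟨hx, hlt⟩)
      · exact ⟨hi, le_rfl⟩
      · exact ⟨hx, hlt.le⟩
  have hB : (univ : Finset α).filter (· ≤ i) = insert i (univ.filter (· < i)) := by
    ext x
    simp only [mem_filter, mem_univ, true_and, mem_insert]
    constructor
    · intro hle
      rcases hle.lt_or_eq with h | h
      · exact Or.inr h
      · exact Or.inl h
    · rintro (rfl | hlt)
      · exact le_rfl
      · exact hlt.le
  rw [hA, hB]
  exact hf _ _ (fun x hx => by
    simp only [mem_filter, mem_univ, true_and] at hx ⊢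
    exact hx.2) i (by simp)

/-- **Chord inequality for increasing marginals** (the discrete form of "concave `φ` lies above its chords" /
"convex expected dimension lies below its chord through the origin"): under the independent law of rate `θ`,
`𝔼_θ f(G) ≤ f(∅) + θ·(f(univ) − f(∅))` for every `f` with increasing marginals (`P[i ∈ G] = θ` for each coordinate,
and the coordinate-`i` marginal along `G` is at most the full-chain marginal).
[cite: DelfosseZemor2013, §8 Props. 8.4–8.5 (concavity of φ; the point (1−p, φ(1−p)) is above the segment)] -/
theorem sum_bernoulliWeight_mul_le_of_marginal_le (f : Finset α → ℝ)
    (hf : ∀ A B : Finset α, A ⊆ B → ∀ i, i ∉ B → f (insert i A) - f A ≤ f (insert i B) - f B) {θ : ℝ}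
    (h0 : 0 ≤ θ) (h1 : θ ≤ 1) :
    ∑ G : Finset α, bernoulliWeight θ G * f G ≤ f ∅ + θ * (f univ - f ∅) := by
  set c : α → ℝ := fun i => f (univ.filter (· ≤ i)) - f (univ.filter (· < i)) with hc
  have htel : ∑ i, c i = f univ - f ∅ := sum_prefix_telescope f univ
  have hpt : ∀ G : Finset α, bernoulliWeight θ G * f G ≤ bernoulliWeight θ G * (f ∅ + ∑ i ∈ G, c i) :=
    fun G => mul_le_mul_of_nonneg_left (by linarith [sub_le_sum_prefix_of_marginal_le f hf G])
      (bernoulliWeight_nonneg h0 h1 G)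
  have hswap : ∑ G : Finset α, bernoulliWeight θ G * ∑ i ∈ G, c i = θ * ∑ i, c i := by
    have h2 : ∀ G : Finset α, bernoulliWeight θ G * ∑ i ∈ G, c i = ∑ i ∈ G, bernoulliWeight θ G * c i :=
      fun G => Finset.mul_sum _ _ _
    rw [Finset.sum_congr rfl fun G _ => h2 G,
      Finset.sum_comm' (t' := (univ : Finset α)) (s' := fun i => univ.filter fun G : Finset α => i ∈ G)
        (fun G i => by simp), Finset.mul_sum]
    refine Finset.sum_congr rfl fun i _ => ?_
    rw [← Finset.sum_mul]
    congr 1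
    have h := sum_bernoulliWeight_filter_superset θ ({i} : Finset α)
    rw [Finset.card_singleton, pow_one] at h
    have hs : (univ.filter fun G : Finset α => i ∈ G) = univ.filter fun G : Finset α => {i} ⊆ G := by
      ext G
      simp
    rw [hs]
    exact h
  calc ∑ G : Finset α, bernoulliWeight θ G * f G
      ≤ ∑ G : Finset α, bernoulliWeight θ G * (f ∅ + ∑ i ∈ G, c i) := Finset.sum_le_sum fun G _ => hpt G
    _ = f ∅ + θ * (f univ - f ∅) := by
        simp only [mul_add, Finset.sum_add_distrib, ← Finset.sum_mul, sum_bernoulliWeight, one_mul, hswap, htel]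

end Telescoping

/-! ### The rank function: Lemma 3.3, supermodularity of `κ(M) = dim(S̄ ⊓ P(M))` (Lemma 8.1), increasing marginals -/

section RankFunction

variable {n : ℕ} (T : Submodule (ZMod 2) (SympVec n))

/-- `P(∅) = 0`. [cite: BravyiTerhal2009, §2 (𝒫(M))] -/
theorem supportedOn_empty : supportedOn (∅ : Finset (Fin n)) = ⊥ := by
  rw [eq_bot_iff]
  intro v hv
  rw [Submodule.mem_bot]
  ext i
  · exact (hv i (Finset.notMem_empty i)).1
  · exact (hv i (Finset.notMem_empty i)).2

/-- `κ(∅) = 0`: no stabilizer is supported on the empty set. [cite: DelfosseZemor2013, §3.3 Lemma 3.3 (S_ℰ)] -/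
theorem finrank_inf_supportedOn_empty : finrank (ZMod 2) ↥(T ⊓ supportedOn (∅ : Finset (Fin n))) = 0 := by
  rw [supportedOn_empty, inf_bot_eq, finrank_bot]

/-- `κ(univ) = dim S̄`. [cite: DelfosseZemor2013, §3.3 Lemma 3.3 (S_ℰ with ℰ everything)] -/
theorem finrank_inf_supportedOn_univ : finrank (ZMod 2) ↥(T ⊓ supportedOn (univ : Finset (Fin n))) =
    finrank (ZMod 2) T := by
  have h : T ⊓ supportedOn (univ : Finset (Fin n)) = T :=
    le_antisymm inf_le_left (le_inf le_rfl fun v _ i hi => absurd (Finset.mem_univ i) hi)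
  rw [h]

/-- `κ(M) ≤ dim S̄`. [cite: DelfosseZemor2013, §3.3 Lemma 3.3] -/
theorem finrank_inf_supportedOn_le (M : Finset (Fin n)) :
    finrank (ZMod 2) ↥(T ⊓ supportedOn M) ≤ finrank (ZMod 2) T :=
  Submodule.finrank_mono inf_le_left

/-- **Lemma 3.3** (`dim S_ℰ = rank H − rank H_ℰ̄`): `rank H_{Mᶜ} + κ(M) = dim S̄`, where `rank H_{Mᶜ}` is the dimension
of the restriction `ρ_{Mᶜ}(S̄)` of the stabilizer space to the columns outside `M` (rank–nullity for `ρ_{Mᶜ}` on `S̄`,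
whose kernel inside `S̄` is `S̄ ⊓ P(M)`). [cite: DelfosseZemor2013, §3.3 Lemma 3.3 (chunk p0008 L48–L62)] -/
theorem finrank_map_proj_add_finrank_inf_supportedOn (M : Finset (Fin n)) :
    finrank (ZMod 2) ↥(T.map (proj Mᶜ)) + finrank (ZMod 2) ↥(T ⊓ supportedOn M) = finrank (ZMod 2) T := by
  have h := LinearMap.finrank_range_add_finrank_ker ((proj Mᶜ).domRestrict T)
  rw [LinearMap.range_domRestrict, LinearMap.ker_domRestrict, ker_proj, compl_compl] at h
  rw [← h, ← Submodule.finrank_map_subtype_eq T (Submodule.comap T.subtype (supportedOn M)),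
    Submodule.map_comap_subtype]

/-- **Lemma 8.1 in `κ`-form: the dimension of the stabilizers inside `M` is SUPERMODULAR in `M`**,
`κ(X) + κ(Y) ≤ κ(X ∪ Y) + κ(X ∩ Y)` (modular law for `S̄(X)`, `S̄(Y)`: their sum lies in `S̄(X ∪ Y)`, their meet is
`S̄(X ∩ Y)`); equivalently (Lemma 3.3) the rank of `H_A` is submodular in `A`.
[cite: DelfosseZemor2013, §8 Lemma 8.1 (chunk p0021 L8–L60)] -/
theorem finrank_inf_supportedOn_superModular (X Y : Finset (Fin n)) :
    finrank (ZMod 2) ↥(T ⊓ supportedOn X) + finrank (ZMod 2) ↥(T ⊓ supportedOn Y) ≤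
      finrank (ZMod 2) ↥(T ⊓ supportedOn (X ∪ Y)) + finrank (ZMod 2) ↥(T ⊓ supportedOn (X ∩ Y)) := by
  have h := Submodule.finrank_sup_add_finrank_inf_eq (T ⊓ supportedOn X) (T ⊓ supportedOn Y)
  have h1 : (T ⊓ supportedOn X) ⊔ (T ⊓ supportedOn Y) ≤ T ⊓ supportedOn (X ∪ Y) :=
    sup_le (inf_le_inf_left _ (supportedOn_mono subset_union_left))
      (inf_le_inf_left _ (supportedOn_mono subset_union_right))
  have h2 : (T ⊓ supportedOn X) ⊓ (T ⊓ supportedOn Y) ≤ T ⊓ supportedOn (X ∩ Y) := by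
    rintro v ⟨⟨hvT, hvX⟩, -, hvY⟩
    exact ⟨hvT, mem_supportedOn_inter hvX hvY⟩
  have h3 := Submodule.finrank_mono h1
  have h4 := Submodule.finrank_mono h2
  omega

/-- **Increasing marginals of `G ↦ κ(E ∩ G)`**: for `A ⊆ B ∌ i`,
`κ(E ∩ (A ∪ {i})) − κ(E ∩ A) ≤ κ(E ∩ (B ∪ {i})) − κ(E ∩ B)`.
[cite: DelfosseZemor2013, §8 Lemma 8.2 (the second differences have a sign, by Lemma 8.1)] -/
theorem finrank_inf_supportedOn_inter_marginal_le (E A B : Finset (Fin n)) (hAB : A ⊆ B) (i : Fin n)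
    (hi : i ∉ B) :
    (finrank (ZMod 2) ↥(T ⊓ supportedOn (E ∩ insert i A)) : ℝ) - finrank (ZMod 2) ↥(T ⊓ supportedOn (E ∩ A)) ≤
      (finrank (ZMod 2) ↥(T ⊓ supportedOn (E ∩ insert i B)) : ℝ) - finrank (ZMod 2) ↥(T ⊓ supportedOn (E ∩ B)) := by
  have h := finrank_inf_supportedOn_superModular T (E ∩ insert i A) (E ∩ B)
  have hu : E ∩ insert i A ∪ E ∩ B = E ∩ insert i B := by
    rw [← Finset.inter_union_distrib_left, Finset.insert_union, Finset.union_eq_right.2 hAB]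
  have hi' : E ∩ insert i A ∩ (E ∩ B) = E ∩ A := by
    ext x
    simp only [mem_inter, mem_insert]
    constructor
    · rintro ⟨⟨hx, rfl | hxA⟩, -, hxB⟩
      · exact absurd hxB hi
      · exact ⟨hx, hxA⟩
    · rintro ⟨hx, hxA⟩
      exact ⟨⟨hx, Or.inr hxA⟩, hx, hAB hxA⟩
  rw [hu, hi'] at h
  have h' : (finrank (ZMod 2) ↥(T ⊓ supportedOn (E ∩ insert i A)) : ℝ) +
      finrank (ZMod 2) ↥(T ⊓ supportedOn (E ∩ B)) ≤
        (finrank (ZMod 2) ↥(T ⊓ supportedOn (E ∩ insert i B)) : ℝ) + finrank (ZMod 2) ↥(T ⊓ supportedOn (E ∩ A)) := by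
    exact_mod_cast h
  linarith

/-! ### The expected dimension `K(p) = 𝔼_p κ(ℰ)`: thinning, chord inequality (Prop. 8.5), monotonicity (Prop. 8.3) -/

/-- **`K(qθ) ≤ θ·K(q)`** (thin a `Ber(q)` pattern by an independent `Ber(θ)` pattern and apply the chord inequality to
the supermodular `G ↦ κ(ℰ ∩ G)`): the expected stabilizer dimension is convex-below-its-chord through the origin.
[cite: DelfosseZemor2013, §8 Props. 8.4–8.5 (chunk p0022 L4–L30)] -/
theorem supportedDim_thinning_le {q θ : ℝ} (hq0 : 0 ≤ q) (hq1 : q ≤ 1) (h0 : 0 ≤ θ) (h1 : θ ≤ 1) :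
    ∑ M : Finset (Fin n), bernoulliWeight (q * θ) M * (finrank (ZMod 2) ↥(T ⊓ supportedOn M) : ℝ) ≤
      θ * ∑ M : Finset (Fin n), bernoulliWeight q M * (finrank (ZMod 2) ↥(T ⊓ supportedOn M) : ℝ) := by
  rw [← sum_bernoulliWeight_mul_sum_inter q θ (fun M => (finrank (ZMod 2) ↥(T ⊓ supportedOn M) : ℝ)),
    Finset.mul_sum]
  refine Finset.sum_le_sum fun A _ => ?_
  rw [← mul_assoc, mul_comm θ, mul_assoc]
  refine mul_le_mul_of_nonneg_left ?_ (bernoulliWeight_nonneg hq0 hq1 A)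
  have h := sum_bernoulliWeight_mul_le_of_marginal_le
    (fun B : Finset (Fin n) => (finrank (ZMod 2) ↥(T ⊓ supportedOn (A ∩ B)) : ℝ))
    (fun A' B' hAB i hi => finrank_inf_supportedOn_inter_marginal_le T A A' B' hAB i hi) h0 h1
  rw [Finset.inter_empty, Finset.inter_univ, finrank_inf_supportedOn_empty, Nat.cast_zero, zero_add,
    sub_zero] at h
  exact h

/-- **Prop. 8.5 (chord inequality), `κ`-form**: `(1−p)·K(p) ≤ p·K(1−p)` for `0 ≤ p ≤ 1/2`, i.e. the printed
`Δ(p) = φ(1−p) − φ(p) ≥ ((1−2p)/(1−p))·(rank H/n − φ(p))` with `n·φ(p) = dim S̄ − K(1−p)`.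
[cite: DelfosseZemor2013, §8 Prop. 8.5 and §3.5 eq. (fconcave)] -/
theorem supportedDim_chord {p : ℝ} (hp0 : 0 ≤ p) (hp : p ≤ 1 / 2) :
    (1 - p) * ∑ M : Finset (Fin n), bernoulliWeight p M * (finrank (ZMod 2) ↥(T ⊓ supportedOn M) : ℝ) ≤
      p * ∑ M : Finset (Fin n), bernoulliWeight (1 - p) M * (finrank (ZMod 2) ↥(T ⊓ supportedOn M) : ℝ) := by
  have h1p : 0 < 1 - p := by linarith
  have h := supportedDim_thinning_le T (q := 1 - p) (θ := p / (1 - p)) h1p.le (by linarith)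
    (div_nonneg hp0 h1p.le) (by rw [div_le_one h1p]; linarith)
  rw [mul_div_cancel₀ p h1p.ne'] at h
  have h' := mul_le_mul_of_nonneg_left h h1p.le
  rwa [← mul_assoc, mul_div_cancel₀ p h1p.ne'] at h'

/-- **Prop. 8.3 / Cor. 3.7, `κ`-form**: `K(p) ≤ K(1−p)` for `0 ≤ p ≤ 1/2` (so the rank difference `Δ(p)` is
non-negative and Thm. 3.5 contains `R ≤ 1 − 2p`). [cite: DelfosseZemor2013, §8 Prop. 8.3 and §3.4 Cor. 3.7] -/
theorem supportedDim_le_reflect {p : ℝ} (hp0 : 0 ≤ p) (hp : p ≤ 1 / 2) :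
    ∑ M : Finset (Fin n), bernoulliWeight p M * (finrank (ZMod 2) ↥(T ⊓ supportedOn M) : ℝ) ≤
      ∑ M : Finset (Fin n), bernoulliWeight (1 - p) M * (finrank (ZMod 2) ↥(T ⊓ supportedOn M) : ℝ) := by
  have h := supportedDim_chord T hp0 hp
  have hK : 0 ≤ ∑ M : Finset (Fin n), bernoulliWeight (1 - p) M * (finrank (ZMod 2) ↥(T ⊓ supportedOn M) : ℝ) :=
    Finset.sum_nonneg fun M _ => mul_nonneg (bernoulliWeight_nonneg (by linarith) (by linarith) M) (Nat.cast_nonneg _)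
  have hK' : 0 ≤ ∑ M : Finset (Fin n), bernoulliWeight p M * (finrank (ZMod 2) ↥(T ⊓ supportedOn M) : ℝ) :=
    Finset.sum_nonneg fun M _ => mul_nonneg (bernoulliWeight_nonneg hp0 (by linarith) M) (Nat.cast_nonneg _)
  nlinarith

end RankFunction

/-! ### Theorem 3.5 (finite form): the count `2pn − dim S̄ + n·Δ(p) ≤ 2n·P_p[non-correctable]` -/

section RankDifference

variable {n : ℕ} (T : Submodule (ZMod 2) (SympVec n))

open Classical in
/-- **The count, pointwise** ("the erasure `ℰ` can be corrected only if `2|ℰ| ≤ rank H + rank H_ℰ − rank H_ℰ̄`"):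
`2|M| + κ(Mᶜ) − dim S̄ − κ(M) ≤ 2n·𝟙[M non-correctable]` — for a correctable `M` the logical operators inside `M` are
stabilizers (`S̄⊥ ⊓ P(M) ≤ S̄ ⊓ P(M)`) and the cleaning count `2|M| + κ(Mᶜ) ≤ dim(S̄⊥ ⊓ P(M)) + dim S̄` applies.
[cite: DelfosseZemor2013, §3.3 Lemmas 3.2–3.3 and eq. (rank_equation_idea) (chunk p0008 L64–L74); BravyiTerhal2009, §2 Lemma 1] -/
theorem erasure_count_le_indicator (M : Finset (Fin n)) :
    2 * (M.card : ℝ) + finrank (ZMod 2) ↥(T ⊓ supportedOn Mᶜ) - finrank (ZMod 2) T -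
        finrank (ZMod 2) ↥(T ⊓ supportedOn M) ≤
      2 * n * (if IsCorrectableRegion T M then 0 else 1) := by
  have hclean := finrank_sympDual_inf_supportedOn_ge T M
  by_cases hM : IsCorrectableRegion T M
  · rw [if_pos hM, mul_zero]
    have hle : (sympDual T ⊓ supportedOn M : Submodule (ZMod 2) (SympVec n)) ≤ T ⊓ supportedOn M :=
      fun v hv => ⟨hM v hv.1 hv.2, hv.2⟩
    have h1 := Submodule.finrank_mono hle
    have h2 : 2 * M.card + finrank (ZMod 2) ↥(T ⊓ supportedOn Mᶜ) ≤
        finrank (ZMod 2) ↥(T ⊓ supportedOn M) + finrank (ZMod 2) T := by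
      have : finrank (ZMod 2) ↥(sympDual T ⊓ supportedOn M) ≤ finrank (ZMod 2) ↥(T ⊓ supportedOn M) := h1
      omega
    have h3 : 2 * (M.card : ℝ) + finrank (ZMod 2) ↥(T ⊓ supportedOn Mᶜ) ≤
        finrank (ZMod 2) ↥(T ⊓ supportedOn M) + finrank (ZMod 2) T := by exact_mod_cast h2
    linarith
  · rw [if_neg hM, mul_one]
    have h1 : (M.card : ℝ) ≤ n := by
      have := M.card_le_univ
      rw [Fintype.card_fin] at this
      exact_mod_cast this
    have h2 : (finrank (ZMod 2) ↥(T ⊓ supportedOn Mᶜ) : ℝ) ≤ finrank (ZMod 2) T := by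
      exact_mod_cast finrank_inf_supportedOn_le T Mᶜ
    have h3 : (0 : ℝ) ≤ finrank (ZMod 2) ↥(T ⊓ supportedOn M) := Nat.cast_nonneg _
    linarith

open Classical in
/-- **THEOREM 3.5 (Delfosse–Zémor), finite form.** For EVERY subspace `S̄ ≤ 𝔽₂ⁿ × 𝔽₂ⁿ` and every erasure rate
`0 ≤ p ≤ 1`: `2pn − dim S̄ + (K(1−p) − K(p)) ≤ 2n·P_p[erasure non-correctable]`, where
`K(p) = Σ_M p^{|M|}(1−p)^{n−|M|} dim(S̄ ⊓ P(M))` and `K(1−p) − K(p) = n·Δ(p)` is the (un-normalised) rank difference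
`𝔼_p[rank H_ℰ̄ − rank H_ℰ]`. With `dim S̄ = (1 − R)n` and `P → 0` this is the printed `R ≤ 1 − 2p − D(p)`.
[cite: DelfosseZemor2013, §3.4 Def. 3.4 and Thm. 3.5 (chunk p0008 L88–L104, proof p0009)] -/
theorem DelfosseZemor_rankDifference_bound {p : ℝ} (hp0 : 0 ≤ p) (hp1 : p ≤ 1) :
    2 * p * n - finrank (ZMod 2) T +
        (∑ M : Finset (Fin n), bernoulliWeight (1 - p) M * (finrank (ZMod 2) ↥(T ⊓ supportedOn M) : ℝ) -
          ∑ M : Finset (Fin n), bernoulliWeight p M * (finrank (ZMod 2) ↥(T ⊓ supportedOn M) : ℝ)) ≤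
      2 * n * eventProb (fun M : Finset (Fin n) => ¬ IsCorrectableRegion T M) p := by
  have hsum := Finset.sum_le_sum fun M (_ : M ∈ (univ : Finset (Finset (Fin n)))) =>
    mul_le_mul_of_nonneg_left (erasure_count_le_indicator T M) (bernoulliWeight_nonneg hp0 hp1 M)
  have hL : ∑ M : Finset (Fin n), bernoulliWeight p M *
      (2 * (M.card : ℝ) + finrank (ZMod 2) ↥(T ⊓ supportedOn Mᶜ) - finrank (ZMod 2) T -
        finrank (ZMod 2) ↥(T ⊓ supportedOn M)) =
      2 * p * n - finrank (ZMod 2) T +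
        (∑ M : Finset (Fin n), bernoulliWeight (1 - p) M * (finrank (ZMod 2) ↥(T ⊓ supportedOn M) : ℝ) -
          ∑ M : Finset (Fin n), bernoulliWeight p M * (finrank (ZMod 2) ↥(T ⊓ supportedOn M) : ℝ)) := by
    simp only [mul_sub, mul_add, Finset.sum_sub_distrib, Finset.sum_add_distrib]
    rw [sum_bernoulliWeight_mul_apply_compl p (fun M => (finrank (ZMod 2) ↥(T ⊓ supportedOn M) : ℝ)),
      ← Finset.sum_mul, sum_bernoulliWeight, one_mul]
    have hc : ∑ M : Finset (Fin n), bernoulliWeight p M * (2 * (M.card : ℝ)) = 2 * p * n := by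
      have : ∀ M : Finset (Fin n), bernoulliWeight p M * (2 * (M.card : ℝ)) = 2 * (bernoulliWeight p M * M.card) :=
        fun M => by ring
      rw [Finset.sum_congr rfl fun M _ => this M, ← Finset.mul_sum, sum_bernoulliWeight_mul_card, Fintype.card_fin]
      ring
    rw [hc]
    ring
  have hR : ∑ M : Finset (Fin n), bernoulliWeight p M * (2 * n * (if IsCorrectableRegion T M then (0 : ℝ) else 1)) =
      2 * n * eventProb (fun M : Finset (Fin n) => ¬ IsCorrectableRegion T M) p := by
    have : ∀ M : Finset (Fin n), bernoulliWeight p M * (2 * n * (if IsCorrectableRegion T M then (0 : ℝ) else 1)) =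
        2 * n * (bernoulliWeight p M * (if IsCorrectableRegion T M then (0 : ℝ) else 1)) := fun M => by ring
    rw [Finset.sum_congr rfl fun M _ => this M, ← Finset.mul_sum, sum_bernoulliWeight_mul_ite_eq_eventProb_not]
  rw [hL, hR] at hsum
  exact hsum

open Classical in
/-- `[[n,k]]` form of Theorem 3.5: for a stabilizer space with `dim S̄ + k = n` and `0 ≤ p ≤ 1`,
`k ≤ n·(1 − 2p) + 2n·P_p[non-correctable] − (K(1−p) − K(p))` — the tree's `k ≤ n(1 − 2ε + 2P_ε)`
(`stabilizer_k_le_card_mul_quantumErasure`) sharpened by the rank difference `n·Δ(p) = K(1−p) − K(p)`.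
[cite: DelfosseZemor2013, §3.4 Thm. 3.5] -/
theorem k_le_of_rankDifference {k : ℕ} (hk : finrank (ZMod 2) T + k = n) {p : ℝ} (hp0 : 0 ≤ p) (hp1 : p ≤ 1) :
    (k : ℝ) ≤ n * (1 - 2 * p) + 2 * n * eventProb (fun M : Finset (Fin n) => ¬ IsCorrectableRegion T M) p -
      (∑ M : Finset (Fin n), bernoulliWeight (1 - p) M * (finrank (ZMod 2) ↥(T ⊓ supportedOn M) : ℝ) -
        ∑ M : Finset (Fin n), bernoulliWeight p M * (finrank (ZMod 2) ↥(T ⊓ supportedOn M) : ℝ)) := by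
  have h := DelfosseZemor_rankDifference_bound T hp0 hp1
  have hk' : (finrank (ZMod 2) T : ℝ) + k = n := by exact_mod_cast hk
  linarith

end RankDifference

/-! ### Generators of weight `≤ m`: `K(q) ≥ dim S̄ · q^m` -/

section Generators

variable {n : ℕ} (T : Submodule (ZMod 2) (SympVec n))

/-- Independent stabilizers supported inside `M` count towards `κ(M)`: for a linearly independent finite family
`t ⊆ S̄`, `#{v ∈ t : supp v ⊆ M} ≤ dim(S̄ ⊓ P(M))`. [cite: DelfosseZemor2013, §3.5 proof of Thm. 3.8 (h⁰_ℰ, the zero rows of H_ℰ)] -/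
theorem card_filter_sympSupport_subset_le {t : Finset (SympVec n)} (hli : LinearIndepOn (ZMod 2) id (t : Set (SympVec n)))
    (htT : ∀ v ∈ t, v ∈ T) (M : Finset (Fin n)) :
    (t.filter fun v => sympSupport v ⊆ M).card ≤ finrank (ZMod 2) ↥(T ⊓ supportedOn M) := by
  have hli' : LinearIndepOn (ZMod 2) id ((t.filter fun v => sympSupport v ⊆ M : Finset (SympVec n)) : Set (SympVec n)) :=
    hli.mono (by
      rw [Finset.coe_filter]
      intro v hv
      exact hv.1)
  rw [← finrank_span_finset_eq_card hli']
  refine Submodule.finrank_mono ?_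
  rw [Submodule.span_le]
  intro v hv
  have hv' := Finset.mem_filter.1 (Finset.mem_coe.1 hv)
  exact ⟨htT v hv'.1, mem_supportedOn_of_forall_sympSupport fun _ hq => hv'.2 hq⟩

/-- The expected number of members of `t` inside a `Ber(q)` pattern is `Σ_{v ∈ t} q^{wt v}`
(`P[supp v ⊆ ℰ] = q^{wt v}`). [cite: DelfosseZemor2013, §3.5 proof of Thm. 3.8 (𝔼_p(h⁰_ℰ) ≥ rank H·(1−p)^m)] -/
theorem sum_bernoulliWeight_mul_card_filter_sympSupport_subset (q : ℝ) (t : Finset (SympVec n)) :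
    ∑ M : Finset (Fin n), bernoulliWeight q M * ((t.filter fun v => sympSupport v ⊆ M).card : ℝ) =
      ∑ v ∈ t, q ^ sympWeight v := by
  have h1 : ∀ M : Finset (Fin n), bernoulliWeight q M * ((t.filter fun v => sympSupport v ⊆ M).card : ℝ) =
      ∑ v ∈ t, if sympSupport v ⊆ M then bernoulliWeight q M else 0 := by
    intro M
    rw [Finset.card_filter, Nat.cast_sum, Finset.mul_sum]
    refine Finset.sum_congr rfl fun v _ => ?_
    split_ifs <;> simp
  rw [Finset.sum_congr rfl fun M _ => h1 M, Finset.sum_comm]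
  refine Finset.sum_congr rfl fun v _ => ?_
  rw [← Finset.sum_filter, sum_bernoulliWeight_filter_superset, card_sympSupport]

/-- **`K(q) ≥ dim S̄ · q^m`** for a stabilizer space spanned by vectors of symplectic weight `≤ m` (`0 ≤ q ≤ 1`): choose a
basis of `S̄` among the generators; each basis vector lies inside the pattern with probability `q^{wt} ≥ q^m`, and
independent stabilizers inside `M` contribute to `κ(M)` — the printed `φ(p) ≤ (rank H/n)(1 − (1−p)^m)`.
[cite: DelfosseZemor2013, §3.5 proof of Thm. 3.8 (chunk p0010 L1–L12)] -/
theorem finrank_mul_pow_le_supportedDim {m : ℕ} {G : Set (SympVec n)} (hG : ∀ v ∈ G, sympWeight v ≤ m)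
    (hspan : Submodule.span (ZMod 2) G = T) {q : ℝ} (hq0 : 0 ≤ q) (hq1 : q ≤ 1) :
    (finrank (ZMod 2) T : ℝ) * q ^ m ≤
      ∑ M : Finset (Fin n), bernoulliWeight q M * (finrank (ZMod 2) ↥(T ⊓ supportedOn M) : ℝ) := by
  classical
  obtain ⟨b, hbG, hbspan, hbli⟩ := exists_linearIndependent (ZMod 2) G
  have hbfin : b.Finite := Set.toFinite b
  set t : Finset (SympVec n) := hbfin.toFinset with ht
  have htb : (t : Set (SympVec n)) = b := hbfin.coe_toFinset
  have hli : LinearIndepOn (ZMod 2) id (t : Set (SympVec n)) := by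
    rw [htb]
    exact hbli
  have hcard : finrank (ZMod 2) T = t.card := by
    rw [← finrank_span_finset_eq_card hli, htb, hbspan, hspan]
  have htT : ∀ v ∈ t, v ∈ T := by
    intro v hv
    rw [← hspan]
    exact Submodule.subset_span (hbG (by rwa [ht, Set.Finite.mem_toFinset] at hv))
  have hwt : ∀ v ∈ t, sympWeight v ≤ m := fun v hv =>
    hG v (hbG (by rwa [ht, Set.Finite.mem_toFinset] at hv))
  calc (finrank (ZMod 2) T : ℝ) * q ^ m = ∑ v ∈ t, q ^ m := by
        rw [Finset.sum_const, nsmul_eq_mul, hcard]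
    _ ≤ ∑ v ∈ t, q ^ sympWeight v := Finset.sum_le_sum fun v hv => pow_le_pow_of_le_one hq0 hq1 (hwt v hv)
    _ = ∑ M : Finset (Fin n), bernoulliWeight q M * ((t.filter fun v => sympSupport v ⊆ M).card : ℝ) :=
        (sum_bernoulliWeight_mul_card_filter_sympSupport_subset q t).symm
    _ ≤ ∑ M : Finset (Fin n), bernoulliWeight q M * (finrank (ZMod 2) ↥(T ⊓ supportedOn M) : ℝ) :=
        Finset.sum_le_sum fun M _ => mul_le_mul_of_nonneg_left
          (by exact_mod_cast card_filter_sympSupport_subset_le T hli htT M) (bernoulliWeight_nonneg hq0 hq1 M)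

/-- Weight-`0` generators span the zero space. [cite: DelfosseZemor2013, §2.4 (|E| = number of non-identity components)] -/
theorem finrank_eq_zero_of_sympWeight_le_zero {G : Set (SympVec n)} (hG : ∀ v ∈ G, sympWeight v ≤ 0)
    (hspan : Submodule.span (ZMod 2) G = T) : finrank (ZMod 2) T = 0 := by
  have hbot : T = ⊥ := by
    rw [← hspan, Submodule.span_eq_bot]
    intro v hv
    exact (sympWeight_eq_zero_iff v).1 (Nat.le_zero.1 (hG v hv))
  rw [hbot, finrank_bot]

/-- **The rank difference of a bounded-weight stabilizer space**: if `S̄` is spanned by vectors of weight `≤ m` then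
`(1−2p)(1−p)^{m−1}·dim S̄ ≤ K(1−p) − K(p)` for `0 ≤ p ≤ 1/2` — the printed
`Δ(p) ≥ ((1−2p)/(1−p))·(rank H/n)·(1−p)^m`. [cite: DelfosseZemor2013, §3.5 proof of Thm. 3.8 (chunk p0010 L8–L16)] -/
theorem rankDifference_ge_of_boundedWeight {m : ℕ} {G : Set (SympVec n)} (hG : ∀ v ∈ G, sympWeight v ≤ m)
    (hspan : Submodule.span (ZMod 2) G = T) {p : ℝ} (hp0 : 0 ≤ p) (hp : p ≤ 1 / 2) :
    (1 - 2 * p) * (1 - p) ^ (m - 1) * finrank (ZMod 2) T ≤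
      ∑ M : Finset (Fin n), bernoulliWeight (1 - p) M * (finrank (ZMod 2) ↥(T ⊓ supportedOn M) : ℝ) -
        ∑ M : Finset (Fin n), bernoulliWeight p M * (finrank (ZMod 2) ↥(T ⊓ supportedOn M) : ℝ) := by
  set Kq := ∑ M : Finset (Fin n), bernoulliWeight (1 - p) M * (finrank (ZMod 2) ↥(T ⊓ supportedOn M) : ℝ) with hKq
  set Kp := ∑ M : Finset (Fin n), bernoulliWeight p M * (finrank (ZMod 2) ↥(T ⊓ supportedOn M) : ℝ) with hKp
  have h1p : 0 < 1 - p := by linarith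
  have hchord : (1 - p) * Kp ≤ p * Kq := supportedDim_chord T hp0 hp
  have hgen : (finrank (ZMod 2) T : ℝ) * (1 - p) ^ m ≤ Kq :=
    finrank_mul_pow_le_supportedDim T hG hspan h1p.le (by linarith)
  have hs0 : (0 : ℝ) ≤ finrank (ZMod 2) T := Nat.cast_nonneg _
  -- (1 − p)·(K(1−p) − K(p)) ≥ (1 − 2p)·K(1−p) ≥ (1 − 2p)·dim S̄·(1−p)^m
  have hstep : (1 - 2 * p) * ((finrank (ZMod 2) T : ℝ) * (1 - p) ^ m) ≤ (1 - p) * (Kq - Kp) := by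
    have h12 : 0 ≤ 1 - 2 * p := by linarith
    nlinarith [mul_le_mul_of_nonneg_left hgen h12]
  -- (1 − 2p)·dim S̄·(1−p)^m = (1 − p)·((1 − 2p)(1 − p)^{m−1} dim S̄)  (for m = 0 both sides vanish: dim S̄ = 0)
  have hkey : (1 - 2 * p) * ((finrank (ZMod 2) T : ℝ) * (1 - p) ^ m) =
      (1 - p) * ((1 - 2 * p) * (1 - p) ^ (m - 1) * finrank (ZMod 2) T) := by
    cases m with
    | zero =>
      have h0 : finrank (ZMod 2) T = 0 := finrank_eq_zero_of_sympWeight_le_zero T hG hspan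
      rw [h0]
      simp
    | succ m' =>
      rw [Nat.add_sub_cancel, pow_succ]
      ring
  rw [hkey] at hstep
  exact le_of_mul_le_mul_left hstep h1p

end Generators

/-! ### Theorem 3.8 (finite form): one code -/

section OneCode

variable {n : ℕ} (T : Submodule (ZMod 2) (SympVec n))

open Classical in
/-- **THEOREM 3.8 (Delfosse–Zémor), finite count.** For every subspace `S̄ ≤ 𝔽₂ⁿ × 𝔽₂ⁿ` spanned by vectors of
symplectic weight `≤ m` and every erasure rate `0 ≤ p ≤ 1/2`:
`2pn ≤ dim S̄·(1 − (1−2p)(1−p)^{m−1}) + 2n·P_p[erasure non-correctable]`.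
[cite: DelfosseZemor2013, §3.5 Thm. 3.8 and its proof (chunk p0009 L95 – p0010 L22)] -/
theorem DelfosseZemor_boundedWeight_count {m : ℕ} {G : Set (SympVec n)} (hG : ∀ v ∈ G, sympWeight v ≤ m)
    (hspan : Submodule.span (ZMod 2) G = T) {p : ℝ} (hp0 : 0 ≤ p) (hp : p ≤ 1 / 2) :
    2 * p * n ≤ (finrank (ZMod 2) T : ℝ) * (1 - (1 - 2 * p) * (1 - p) ^ (m - 1)) +
      2 * n * eventProb (fun M : Finset (Fin n) => ¬ IsCorrectableRegion T M) p := by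
  have h1 := DelfosseZemor_rankDifference_bound T hp0 (by linarith)
  have h2 := rankDifference_ge_of_boundedWeight T hG hspan hp0 hp
  nlinarith

open Classical in
/-- **THEOREM 3.8, `[[n,k]]` form.** For a stabilizer space with `dim S̄ + k = n` spanned by vectors of weight `≤ m`
and `0 ≤ p ≤ 1/2`: `k·(1 − (1−2p)(1−p)^{m−1}) ≤ n·(1−2p)·(1 − (1−p)^{m−1}) + 2n·P_p[erasure non-correctable]` —
letting `P → 0` along a family of rate `≥ R` gives the printed
`R ≤ (1−2p)(1−(1−p)^{m−1})/(1−(1−2p)(1−p)^{m−1})`. [cite: DelfosseZemor2013, §3.5 Thm. 3.8 (chunk p0009 L95–L104)] -/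
theorem DelfosseZemor_boundedWeight_k_le {m k : ℕ} {G : Set (SympVec n)} (hG : ∀ v ∈ G, sympWeight v ≤ m)
    (hspan : Submodule.span (ZMod 2) G = T) (hk : finrank (ZMod 2) T + k = n) {p : ℝ} (hp0 : 0 ≤ p)
    (hp : p ≤ 1 / 2) :
    (k : ℝ) * (1 - (1 - 2 * p) * (1 - p) ^ (m - 1)) ≤
      n * ((1 - 2 * p) * (1 - (1 - p) ^ (m - 1))) +
        2 * n * eventProb (fun M : Finset (Fin n) => ¬ IsCorrectableRegion T M) p := by
  have h := DelfosseZemor_boundedWeight_count T hG hspan hp0 hp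
  set u : ℝ := (1 - 2 * p) * (1 - p) ^ (m - 1) with hu
  have hk' : (finrank (ZMod 2) T : ℝ) = n - k := by
    have : (finrank (ZMod 2) T : ℝ) + k = n := by exact_mod_cast hk
    linarith
  rw [hk'] at h
  have : ((n : ℝ) - k) * (1 - u) = n * (1 - u) - k * (1 - u) := by ring
  rw [this] at h
  have : (n : ℝ) * ((1 - 2 * p) * (1 - (1 - p) ^ (m - 1))) = n * (1 - u) - 2 * p * n := by rw [hu]; ring
  rw [this]
  linarith

open Classical in
/-- **`[[n,k,d]]` form**: for an additive code `S̄` (`dim S̄ + k = n`) with a generating set of weight `≤ m` and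
`0 ≤ p ≤ 1/2`, `k·(1 − (1−2p)(1−p)^{m−1}) ≤ n·(1−2p)·(1 − (1−p)^{m−1}) + 2n·P_p[non-correctable]`.
[cite: DelfosseZemor2013, §3.5 Thm. 3.8; CalderbankEtAl1998, §2 Thm. 1 (dim S̄ = n − k)] -/
theorem IsAdditiveCode.DelfosseZemor_boundedWeight {k d m : ℕ} (hcode : IsAdditiveCode T k d) {G : Set (SympVec n)}
    (hG : ∀ v ∈ G, sympWeight v ≤ m) (hspan : Submodule.span (ZMod 2) G = T) {p : ℝ} (hp0 : 0 ≤ p)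
    (hp : p ≤ 1 / 2) :
    (k : ℝ) * (1 - (1 - 2 * p) * (1 - p) ^ (m - 1)) ≤
      n * ((1 - 2 * p) * (1 - (1 - p) ^ (m - 1))) +
        2 * n * eventProb (fun M : Finset (Fin n) => ¬ IsCorrectableRegion T M) p :=
  DelfosseZemor_boundedWeight_k_le T hG hspan hcode.2.1 hp0 hp

end OneCode

/-! ### Theorem 3.8 for families: LDPC stabilizer codes do not achieve the erasure capacity `1 − 2p` -/

section Families

variable {nq : ℕ → ℕ} (S : ∀ i, Submodule (ZMod 2) (SympVec (nq i))) {k d : ℕ → ℕ}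

/-- The coefficient `u(p) = (1−2p)(1−p)^{m−1}` lies in `[0, 1]` for `0 ≤ p ≤ 1/2`. [cite: DelfosseZemor2013, §3.5 Thm. 3.8] -/
theorem dz_coeff_mem_unitInterval (m : ℕ) {p : ℝ} (hp0 : 0 ≤ p) (hp : p ≤ 1 / 2) :
    0 ≤ (1 - 2 * p) * (1 - p) ^ (m - 1) ∧ (1 - 2 * p) * (1 - p) ^ (m - 1) ≤ 1 := by
  have h1 : 0 ≤ 1 - 2 * p := by linarith
  have h2 : (0 : ℝ) ≤ (1 - p) ^ (m - 1) := pow_nonneg (by linarith) _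
  have h3 : (1 - p) ^ (m - 1) ≤ (1 : ℝ) := pow_le_one₀ (by linarith) (by linarith)
  exact ⟨mul_nonneg h1 h2, by nlinarith⟩

open Classical in
/-- **THEOREM 3.8 (Delfosse–Zémor): bounded-weight stabilizer families.** Let `S̄_i ≤ 𝔽₂^{n_i} × 𝔽₂^{n_i}` be a
family of stabilizer codes with `k_i ≥ 1` logical qubits, rate `≥ R` (`R n_i ≤ k_i`), each spanned by vectors of
symplectic weight `≤ m`. If the erasure rate `0 ≤ p ≤ 1/2` is below threshold (`P_p[non-correctable] → 0`), then
`R·(1 − (1−2p)(1−p)^{m−1}) ≤ (1−2p)·(1 − (1−p)^{m−1})`. [cite: DelfosseZemor2013, §3.5 Thm. 3.8 (chunk p0009 L95–L104)] -/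
theorem DelfosseZemor_theorem38 (hcode : ∀ i, IsAdditiveCode (S i) (k i) (d i)) (hk : ∀ i, 1 ≤ k i) {R : ℝ}
    (hR : ∀ i, R * (nq i : ℝ) ≤ k i) {m : ℕ}
    (hgen : ∀ i, ∃ G : Set (SympVec (nq i)), (∀ v ∈ G, sympWeight v ≤ m) ∧ Submodule.span (ZMod 2) G = S i)
    {p : ℝ} (hp0 : 0 ≤ p) (hp : p ≤ 1 / 2)
    (h : BelowThreshold
      (fun i y => eventProb (fun M : Finset (Fin (nq i)) => ¬ IsCorrectableRegion (S i) M) y) p) :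
    R * (1 - (1 - 2 * p) * (1 - p) ^ (m - 1)) ≤ (1 - 2 * p) * (1 - (1 - p) ^ (m - 1)) := by
  set u : ℝ := (1 - 2 * p) * (1 - p) ^ (m - 1) with hu
  obtain ⟨hu0, hu1⟩ := dz_coeff_mem_unitInterval m hp0 hp
  have hbound : ∀ i, R * (1 - u) ≤ (1 - 2 * p) * (1 - (1 - p) ^ (m - 1)) +
      2 * eventProb (fun M : Finset (Fin (nq i)) => ¬ IsCorrectableRegion (S i) M) p := by
    intro i
    obtain ⟨G, hG, hspan⟩ := hgen i
    have hk0 : (1 : ℝ) ≤ k i := by exact_mod_cast hk i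
    have hkn : (k i : ℝ) ≤ nq i := by exact_mod_cast (hcode i).k_le
    have hn : (0 : ℝ) < nq i := by linarith
    have h1 := (hcode i).DelfosseZemor_boundedWeight (S i) hG hspan hp0 hp
    have h2 : R * (nq i : ℝ) * (1 - u) ≤ (k i : ℝ) * (1 - u) :=
      mul_le_mul_of_nonneg_right (hR i) (by linarith)
    have h3 : (nq i : ℝ) * (R * (1 - u)) ≤ (nq i : ℝ) * ((1 - 2 * p) * (1 - (1 - p) ^ (m - 1)) +
        2 * eventProb (fun M : Finset (Fin (nq i)) => ¬ IsCorrectableRegion (S i) M) p) := by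
      rw [hu] at h2 ⊢
      nlinarith
    exact le_of_mul_le_mul_left h3 hn
  have hlim : Tendsto (fun i => (1 - 2 * p) * (1 - (1 - p) ^ (m - 1)) +
      2 * eventProb (fun M : Finset (Fin (nq i)) => ¬ IsCorrectableRegion (S i) M) p) atTop
      (𝓝 ((1 - 2 * p) * (1 - (1 - p) ^ (m - 1)) + 2 * 0)) :=
    tendsto_const_nhds.add (h.const_mul 2)
  have := le_of_tendsto_of_tendsto' tendsto_const_nhds hlim hbound
  rw [hu]
  linarith

open Classical in
/-- **Theorem 3.8 as printed** (quotient form, `0 < p ≤ 1/2`):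
`R ≤ (1−2p)·(1−(1−p)^{m−1}) / (1 − (1−2p)(1−p)^{m−1})`. [cite: DelfosseZemor2013, §3.5 Thm. 3.8 (chunk p0009 L95–L104)] -/
theorem DelfosseZemor_theorem38_div (hcode : ∀ i, IsAdditiveCode (S i) (k i) (d i)) (hk : ∀ i, 1 ≤ k i) {R : ℝ}
    (hR : ∀ i, R * (nq i : ℝ) ≤ k i) {m : ℕ}
    (hgen : ∀ i, ∃ G : Set (SympVec (nq i)), (∀ v ∈ G, sympWeight v ≤ m) ∧ Submodule.span (ZMod 2) G = S i)
    {p : ℝ} (hp0 : 0 < p) (hp : p ≤ 1 / 2)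
    (h : BelowThreshold
      (fun i y => eventProb (fun M : Finset (Fin (nq i)) => ¬ IsCorrectableRegion (S i) M) y) p) :
    R ≤ (1 - 2 * p) * (1 - (1 - p) ^ (m - 1)) / (1 - (1 - 2 * p) * (1 - p) ^ (m - 1)) := by
  have h1 := DelfosseZemor_theorem38 S hcode hk hR hgen hp0.le hp h
  have hlt : (1 - 2 * p) * (1 - p) ^ (m - 1) < 1 := by
    have ha : 1 - 2 * p < 1 := by linarith
    have hb : (1 - p) ^ (m - 1) ≤ (1 : ℝ) := pow_le_one₀ (by linarith) (by linarith)
    have hb0 : (0 : ℝ) ≤ (1 - p) ^ (m - 1) := pow_nonneg (by linarith) _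
    nlinarith
  rw [le_div_iff₀ (by linarith)]
  exact h1

open Classical in
/-- **Capacity gap**: under the hypotheses of Theorem 3.8 (`0 ≤ p ≤ 1/2` below threshold),
`(1 − R)·(1−2p)(1−p)^{m−1} ≤ (1 − 2p) − R` — the rate falls short of the erasure capacity `1 − 2p` by at least
`(1−R)(1−2p)(1−p)^{m−1}` (the printed `R ≤ 1 − 2p − (1−R)(1−2p)(1−p)^{m−1}`).
[cite: DelfosseZemor2013, §3.5 proof of Thm. 3.8 (chunk p0010 L14–L18)] -/
theorem DelfosseZemor_capacity_gap (hcode : ∀ i, IsAdditiveCode (S i) (k i) (d i)) (hk : ∀ i, 1 ≤ k i) {R : ℝ}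
    (hR : ∀ i, R * (nq i : ℝ) ≤ k i) {m : ℕ}
    (hgen : ∀ i, ∃ G : Set (SympVec (nq i)), (∀ v ∈ G, sympWeight v ≤ m) ∧ Submodule.span (ZMod 2) G = S i)
    {p : ℝ} (hp0 : 0 ≤ p) (hp : p ≤ 1 / 2)
    (h : BelowThreshold
      (fun i y => eventProb (fun M : Finset (Fin (nq i)) => ¬ IsCorrectableRegion (S i) M) y) p) :
    (1 - R) * ((1 - 2 * p) * (1 - p) ^ (m - 1)) ≤ (1 - 2 * p) - R := by
  have h1 := DelfosseZemor_theorem38 S hcode hk hR hgen hp0 hp h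
  set u : ℝ := (1 - 2 * p) * (1 - p) ^ (m - 1) with hu
  have : (1 - 2 * p) * (1 - (1 - p) ^ (m - 1)) = (1 - 2 * p) - u := by rw [hu]; ring
  rw [this] at h1
  nlinarith

open Classical in
/-- **Theorem 3.8 at the erasure accuracy threshold.** For a family of stabilizer codes with `k_i ≥ 1`, rate `≥ R`
and generators of weight `≤ m`, the erasure accuracy threshold `ε_c` satisfies
`(1 − R)·(1−2ε_c)(1−ε_c)^{m−1} ≤ (1 − 2ε_c) − R` (the capacity-gap inequality holds at every `0 ≤ p < ε_c`, and both
sides are continuous in `p`; `ε_c ≤ 1/2` by no cloning). [cite: DelfosseZemor2013, §3.5 Thm. 3.8 ("equivalently, an upper bound on the decoding threshold", §1); DennisEtAl2002, §4.6 (p_c)] -/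
theorem DelfosseZemor_capacity_gap_accuracyThreshold (hcode : ∀ i, IsAdditiveCode (S i) (k i) (d i))
    (hk : ∀ i, 1 ≤ k i) {R : ℝ} (hR : ∀ i, R * (nq i : ℝ) ≤ k i) {m : ℕ}
    (hgen : ∀ i, ∃ G : Set (SympVec (nq i)), (∀ v ∈ G, sympWeight v ≤ m) ∧ Submodule.span (ZMod 2) G = S i) :
    (1 - R) * ((1 - 2 * accuracyThreshold
        (fun i y => eventProb (fun M : Finset (Fin (nq i)) => ¬ IsCorrectableRegion (S i) M) y)) *
      (1 - accuracyThreshold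
        (fun i y => eventProb (fun M : Finset (Fin (nq i)) => ¬ IsCorrectableRegion (S i) M) y)) ^ (m - 1)) ≤
      (1 - 2 * accuracyThreshold
        (fun i y => eventProb (fun M : Finset (Fin (nq i)) => ¬ IsCorrectableRegion (S i) M) y)) - R := by
  set a : ℝ := accuracyThreshold
    (fun i y => eventProb (fun M : Finset (Fin (nq i)) => ¬ IsCorrectableRegion (S i) M) y) with ha
  have ha0 : 0 ≤ a := accuracyThreshold_nonneg _
  have ha2 : a ≤ 1 / 2 := stabilizer_erasure_accuracyThreshold_le_half S hcode hk
  have hthr : IsThresholdLowerBound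
      (fun i y => eventProb (fun M : Finset (Fin (nq i)) => ¬ IsCorrectableRegion (S i) M) y) a :=
    isThresholdLowerBound_accuracyThreshold _
  -- the gap function is continuous and non-negative on `[0, a)`
  set g : ℝ → ℝ := fun p => (1 - 2 * p) - R - (1 - R) * ((1 - 2 * p) * (1 - p) ^ (m - 1)) with hg
  have hgc : Continuous g := by
    rw [hg]
    fun_prop
  have hgp : ∀ p, 0 ≤ p → p < a → 0 ≤ g p := by
    intro p hp0 hpa
    have := DelfosseZemor_capacity_gap S hcode hk hR hgen hp0 (by linarith) (hthr p hp0 hpa)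
    rw [hg]
    linarith
  suffices h : 0 ≤ g a by rw [hg] at h; linarith
  rcases eq_or_lt_of_le ha0 with h0 | h0
  · -- `a = 0`: the inequality is an identity
    rw [← h0, hg]
    simp
  · have hmem : Set.Ioo (a / 2) a ∈ 𝓝[<] a := Ioo_mem_nhdsLT (by linarith)
    have hev : ∀ᶠ p in 𝓝[<] a, 0 ≤ g p :=
      Filter.mem_of_superset hmem fun p hp => hgp p (by linarith [hp.1]) hp.2
    exact ge_of_tendsto (hgc.continuousAt.continuousWithinAt.tendsto) hev

open Classical in
/-- **Bounded-weight stabilizer families do not achieve the erasure capacity.** For a family of stabilizer codes with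
`k_i ≥ 1`, rate `≥ R` with `0 < R < 1`, and generators of weight `≤ m`, the erasure accuracy threshold is STRICTLY
below the no-cloning / capacity value: `ε_c < (1 − R)/2` ("any family of stabilizer codes that have stabilizer groups
with generators of weight bounded by a constant, cannot achieve the capacity of the quantum erasure channel").
[cite: DelfosseZemor2013, §1 (chunk p0002) and §3.5 Thm. 3.8; BennettDivincenzoSmolin1997, p. 3218 (Q = 1 − 2ε)] -/
theorem stabilizerLDPC_erasure_accuracyThreshold_lt (hcode : ∀ i, IsAdditiveCode (S i) (k i) (d i))
    (hk : ∀ i, 1 ≤ k i) {R : ℝ} (hR0 : 0 < R) (hR1 : R < 1) (hR : ∀ i, R * (nq i : ℝ) ≤ k i) {m : ℕ}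
    (hgen : ∀ i, ∃ G : Set (SympVec (nq i)), (∀ v ∈ G, sympWeight v ≤ m) ∧ Submodule.span (ZMod 2) G = S i) :
    accuracyThreshold
        (fun i y => eventProb (fun M : Finset (Fin (nq i)) => ¬ IsCorrectableRegion (S i) M) y) <
      (1 - R) / 2 := by
  set a : ℝ := accuracyThreshold
    (fun i y => eventProb (fun M : Finset (Fin (nq i)) => ¬ IsCorrectableRegion (S i) M) y) with ha
  have hle : a ≤ (1 - R) / 2 := stabilizer_quantumErasure_accuracyThreshold_le_half_sub_rate S hcode hk hR
  have hgap := DelfosseZemor_capacity_gap_accuracyThreshold S hcode hk hR hgen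
  rw [← ha] at hgap
  rcases eq_or_lt_of_le hle with heq | hlt
  · exfalso
    rw [heq] at hgap
    have h1 : (1 : ℝ) - 2 * ((1 - R) / 2) = R := by ring
    rw [h1, sub_self] at hgap
    have h2 : (0 : ℝ) < (1 - (1 - R) / 2) ^ (m - 1) := pow_pos (by linarith) _
    have h3 : 0 < (1 - R) * (R * (1 - (1 - R) / 2) ^ (m - 1)) := mul_pos (by linarith) (mul_pos hR0 h2)
    linarith
  · exact hlt

end Families

/-! ### CSS codes: generators of weight `≤ m` from the check rows; Theorem 3.8 for CSS census families -/

section CSS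

variable {n : ℕ}

/-- The symplectic weight of an `X`-type row vector `(r | 0)` is the Hamming weight of the row.
[cite: DelfosseZemor2013, §2.6–§2.7 (θ : Xᵢ ↦ (eᵢ|0); rows of H_X as binary vectors)] -/
theorem sympWeight_inl_row {RX : Type*} (H : Matrix RX (Fin n) (ZMod 2)) (r : RX) :
    sympWeight ((LinearMap.inl (ZMod 2) (Fin n → ZMod 2) (Fin n → ZMod 2)) (H.row r)) = (rowSupp H r).card := by
  unfold sympWeight rowSupp
  congr 1
  ext i
  simp [Matrix.row]

/-- The symplectic weight of a `Z`-type row vector `(0 | r)` is the Hamming weight of the row.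
[cite: DelfosseZemor2013, §2.6–§2.7 (θ : Zᵢ ↦ (0|eᵢ); rows of H_Z as binary vectors)] -/
theorem sympWeight_inr_row {RZ : Type*} (H : Matrix RZ (Fin n) (ZMod 2)) (r : RZ) :
    sympWeight ((LinearMap.inr (ZMod 2) (Fin n → ZMod 2) (Fin n → ZMod 2)) (H.row r)) = (rowSupp H r).card := by
  unfold sympWeight rowSupp
  congr 1
  ext i
  simp [Matrix.row]

variable {RX RZ : Type*} [Fintype RX] [Fintype RZ]

/-- **The stabilizer space of a CSS code is spanned by its check rows**: `rs H^X × rs H^Z =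
span{(r|0) : r a row of H^X} + span{(0|r) : r a row of H^Z}`. [cite: DelfosseZemor2013, §2.7 (the stabilizer matrix of a CSS code decomposes into H_X and H_Z); NielsenChuang2010, §10.5.6 eq. (10.106)] -/
theorem CSSCode.toSympCode_eq_span_rows (C : CSSCode RX RZ (Fin n)) :
    C.toSympCode = Submodule.span (ZMod 2)
      ((LinearMap.inl (ZMod 2) (Fin n → ZMod 2) (Fin n → ZMod 2)) '' Set.range C.HX.row ∪
        (LinearMap.inr (ZMod 2) (Fin n → ZMod 2) (Fin n → ZMod 2)) '' Set.range C.HZ.row) := by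
  rw [LinearMap.span_inl_union_inr, CSSCode.toSympCode]
  show (rowSpace C.HX).prod (rowSpace C.HZ) = _
  rw [rowSpace, rowSpace, range_vecMulLinear, range_vecMulLinear]

/-- **A CSS code with check rows of weight `≤ m` is a weight-`≤ m` stabilizer code**: its stabilizer space is spanned
by vectors of symplectic weight `≤ m` (the hypothesis `hgen` of Theorem 3.8).
[cite: DelfosseZemor2013, §3.5 Thm. 3.8 ("a set of generators of its stabilizer group whose weights are all upper bounded by m") with §2.7] -/
theorem CSSCode.exists_generators_sympWeight_le (C : CSSCode RX RZ (Fin n)) {m : ℕ}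
    (hX : ∀ r, (rowSupp C.HX r).card ≤ m) (hZ : ∀ r, (rowSupp C.HZ r).card ≤ m) :
    ∃ G : Set (SympVec n), (∀ v ∈ G, sympWeight v ≤ m) ∧ Submodule.span (ZMod 2) G = C.toSympCode := by
  refine ⟨_, ?_, C.toSympCode_eq_span_rows.symm⟩
  rintro v (⟨_, ⟨r, rfl⟩, rfl⟩ | ⟨_, ⟨r, rfl⟩, rfl⟩)
  · rw [sympWeight_inl_row]
    exact hX r
  · rw [sympWeight_inr_row]
    exact hZ r

open Classical in
/-- **Stabilizer-level erasure failure of a CSS code ≤ sum of the sector failures**: the erasure `M` is non-correctable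
for `rs H^X × rs H^Z` iff it is `Z`-uncorrectable or `X`-uncorrectable (`isCorrectableRegion_toSympCode_iff`), so
`P_y[non-correctable] ≤ P^Z_y[uncorrectable] + P^X_y[uncorrectable]` (`0 ≤ y ≤ 1`).
[cite: DelfosseZemor2013, §3.1 Prop. 3.1 (non-correctable erasures in the CSS case: v ∈ C_X∖C_Z⊥ or v ∈ C_Z∖C_X⊥)] -/
theorem CSSCode.erasureFailure_toSympCode_le_add (C : CSSCode RX RZ (Fin n)) {y : ℝ} (hy0 : 0 ≤ y) (hy1 : y ≤ 1) :
    eventProb (fun M : Finset (Fin n) => ¬ IsCorrectableRegion C.toSympCode M) y ≤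
      ErasureDecoder.uncorrectableProb {x : Fin n → ZMod 2 | C.HX *ᵥ x = 0} (C.rowSpZ : Set (Fin n → ZMod 2)) y +
        ErasureDecoder.uncorrectableProb {x : Fin n → ZMod 2 | C.HZ *ᵥ x = 0} (C.rowSpX : Set (Fin n → ZMod 2)) y := by
  unfold ErasureDecoder.uncorrectableProb
  refine le_trans (eventProb_mono (fun M hM => ?_) hy0 hy1) (eventProb_or_le _ _ hy0 hy1)
  rw [C.isCorrectableRegion_toSympCode_iff M, not_and_or] at hM
  exact hM

open Classical in
/-- **Both sectors below threshold ⇒ the stabilizer-level erasure failure is below threshold** (CSS family on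
`Fin n_i` qubits). [cite: DelfosseZemor2013, §3.1 Prop. 3.1; DennisEtAl2002, §4.3 (below threshold)] -/
theorem CSSCode.belowThreshold_toSympCode_of_sectors {RXs RZs : ℕ → Type*} [∀ i, Fintype (RXs i)]
    [∀ i, Fintype (RZs i)] {nq : ℕ → ℕ} (C : ∀ i, CSSCode (RXs i) (RZs i) (Fin (nq i))) {p : ℝ} (hp0 : 0 ≤ p)
    (hp1 : p ≤ 1)
    (hZ : BelowThreshold (fun i y => ErasureDecoder.uncorrectableProb
      {x : Fin (nq i) → ZMod 2 | (C i).HX *ᵥ x = 0} ((C i).rowSpZ : Set (Fin (nq i) → ZMod 2)) y) p)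
    (hX : BelowThreshold (fun i y => ErasureDecoder.uncorrectableProb
      {x : Fin (nq i) → ZMod 2 | (C i).HZ *ᵥ x = 0} ((C i).rowSpX : Set (Fin (nq i) → ZMod 2)) y) p) :
    BelowThreshold
      (fun i y => eventProb (fun M : Finset (Fin (nq i)) => ¬ IsCorrectableRegion (C i).toSympCode M) y) p := by
  unfold BelowThreshold at hZ hX ⊢
  have h := hZ.add hX
  rw [add_zero] at h
  exact squeeze_zero (fun i => eventProb_nonneg _ hp0 hp1) (fun i => (C i).erasureFailure_toSympCode_le_add hp0 hp1) h

open Classical in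
/-- **THEOREM 3.8 for CSS families** (census form, qubits `Fin n_i`): if every `X`- and `Z`-check row has weight `≤ m`,
`k_i ≥ 1`, the rate is `≥ R` (`R n_i ≤ k_i`) and BOTH sector erasure failures are below threshold at `0 ≤ p ≤ 1/2`,
then `R·(1 − (1−2p)(1−p)^{m−1}) ≤ (1−2p)·(1 − (1−p)^{m−1})`.
[cite: DelfosseZemor2013, §3.5 Thm. 3.8 (chunk p0009 L95–L104) with §2.7 and §3.1 Prop. 3.1] -/
theorem CSSCode.DelfosseZemor_theorem38 {RXs RZs : ℕ → Type*} [∀ i, Fintype (RXs i)] [∀ i, Fintype (RZs i)]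
    {nq : ℕ → ℕ} (C : ∀ i, CSSCode (RXs i) (RZs i) (Fin (nq i))) (hk : ∀ i, 0 < (C i).k) {R : ℝ}
    (hR : ∀ i, R * (nq i : ℝ) ≤ (C i).k) {m : ℕ} (hwX : ∀ i r, (rowSupp (C i).HX r).card ≤ m)
    (hwZ : ∀ i r, (rowSupp (C i).HZ r).card ≤ m) {p : ℝ} (hp0 : 0 ≤ p) (hp : p ≤ 1 / 2)
    (hZ : BelowThreshold (fun i y => ErasureDecoder.uncorrectableProb
      {x : Fin (nq i) → ZMod 2 | (C i).HX *ᵥ x = 0} ((C i).rowSpZ : Set (Fin (nq i) → ZMod 2)) y) p)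
    (hX : BelowThreshold (fun i y => ErasureDecoder.uncorrectableProb
      {x : Fin (nq i) → ZMod 2 | (C i).HZ *ᵥ x = 0} ((C i).rowSpX : Set (Fin (nq i) → ZMod 2)) y) p) :
    R * (1 - (1 - 2 * p) * (1 - p) ^ (m - 1)) ≤ (1 - 2 * p) * (1 - (1 - p) ^ (m - 1)) :=
  _root_.Literature.InformationTheory.QuantumCodes.DelfosseZemor_theorem38 (fun i => (C i).toSympCode)
    (fun i => (C i).isAdditiveCode_toSympCode) hk hR
    (fun i => (C i).exists_generators_sympWeight_le (hwX i) (hwZ i)) hp0 hp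
    (CSSCode.belowThreshold_toSympCode_of_sectors C hp0 (by linarith) hZ hX)

open Classical in
/-- **Capacity gap for CSS families**: under the hypotheses of `CSSCode.DelfosseZemor_theorem38`,
`(1 − R)(1−2p)(1−p)^{m−1} ≤ (1 − 2p) − R`. [cite: DelfosseZemor2013, §3.5 proof of Thm. 3.8 (chunk p0010 L14–L18)] -/
theorem CSSCode.DelfosseZemor_capacity_gap {RXs RZs : ℕ → Type*} [∀ i, Fintype (RXs i)] [∀ i, Fintype (RZs i)]
    {nq : ℕ → ℕ} (C : ∀ i, CSSCode (RXs i) (RZs i) (Fin (nq i))) (hk : ∀ i, 0 < (C i).k) {R : ℝ}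
    (hR : ∀ i, R * (nq i : ℝ) ≤ (C i).k) {m : ℕ} (hwX : ∀ i r, (rowSupp (C i).HX r).card ≤ m)
    (hwZ : ∀ i r, (rowSupp (C i).HZ r).card ≤ m) {p : ℝ} (hp0 : 0 ≤ p) (hp : p ≤ 1 / 2)
    (hZ : BelowThreshold (fun i y => ErasureDecoder.uncorrectableProb
      {x : Fin (nq i) → ZMod 2 | (C i).HX *ᵥ x = 0} ((C i).rowSpZ : Set (Fin (nq i) → ZMod 2)) y) p)
    (hX : BelowThreshold (fun i y => ErasureDecoder.uncorrectableProb
      {x : Fin (nq i) → ZMod 2 | (C i).HZ *ᵥ x = 0} ((C i).rowSpX : Set (Fin (nq i) → ZMod 2)) y) p) :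
    (1 - R) * ((1 - 2 * p) * (1 - p) ^ (m - 1)) ≤ (1 - 2 * p) - R :=
  _root_.Literature.InformationTheory.QuantumCodes.DelfosseZemor_capacity_gap (fun i => (C i).toSympCode)
    (fun i => (C i).isAdditiveCode_toSympCode) hk hR
    (fun i => (C i).exists_generators_sympWeight_le (hwX i) (hwZ i)) hp0 hp
    (CSSCode.belowThreshold_toSympCode_of_sectors C hp0 (by linarith) hZ hX)

open Classical in
/-- **LDPC CSS families do not reach the erasure capacity in both sectors at once**: if `a` is a certified erasure
threshold lower bound for BOTH the `Z`- and the `X`-sector of a CSS family with check rows of weight `≤ m`, `k_i ≥ 1`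
and rate `≥ R` with `0 < R < 1`, then `a < (1 − R)/2` STRICTLY (the BDS97 value `(1 − R)/2` of
`erasure_thresholds_add_le_one_sub_rate` with `a = b` is never attained by bounded-weight checks).
[cite: DelfosseZemor2013, §1 ("cannot achieve the capacity") and §3.5 Thm. 3.8; BennettDivincenzoSmolin1997, p. 3218] -/
theorem CSSCode.erasure_threshold_lt_half_sub_rate_of_rowWeight_le {RXs RZs : ℕ → Type*}
    [∀ i, Fintype (RXs i)] [∀ i, Fintype (RZs i)] {nq : ℕ → ℕ} (C : ∀ i, CSSCode (RXs i) (RZs i) (Fin (nq i)))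
    (hk : ∀ i, 0 < (C i).k) {R : ℝ} (hR0 : 0 < R) (hR1 : R < 1) (hR : ∀ i, R * (nq i : ℝ) ≤ (C i).k) {m : ℕ}
    (hwX : ∀ i r, (rowSupp (C i).HX r).card ≤ m) (hwZ : ∀ i r, (rowSupp (C i).HZ r).card ≤ m) {a : ℝ}
    (haZ : IsThresholdLowerBound (fun i y => ErasureDecoder.uncorrectableProb
      {x : Fin (nq i) → ZMod 2 | (C i).HX *ᵥ x = 0} ((C i).rowSpZ : Set (Fin (nq i) → ZMod 2)) y) a)
    (haX : IsThresholdLowerBound (fun i y => ErasureDecoder.uncorrectableProb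
      {x : Fin (nq i) → ZMod 2 | (C i).HZ *ᵥ x = 0} ((C i).rowSpX : Set (Fin (nq i) → ZMod 2)) y) a) :
    a < (1 - R) / 2 := by
  have hlt := stabilizerLDPC_erasure_accuracyThreshold_lt (fun i => (C i).toSympCode)
    (fun i => (C i).isAdditiveCode_toSympCode) hk hR0 hR1 hR
    (fun i => (C i).exists_generators_sympWeight_le (hwX i) (hwZ i))
  refine lt_of_le_of_lt ?_ hlt
  by_cases ha1 : a ≤ 1
  · refine le_accuracyThreshold (fun p hp0 hpa => ?_) ha1
    have hp1 : p ≤ 1 := by linarith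
    exact CSSCode.belowThreshold_toSympCode_of_sectors C hp0 hp1 (haZ p hp0 hpa) (haX p hp0 hpa)
  · -- a threshold lower bound `> 1` would put the rate `1` below threshold, contradicting no cloning
    exfalso
    push Not at ha1
    have h1 := CSSCode.belowThreshold_toSympCode_of_sectors C (p := 1) (by norm_num) le_rfl
      (haZ 1 (by norm_num) ha1) (haX 1 (by norm_num) ha1)
    exact stabilizer_erasure_not_belowThreshold_of_half_le (fun i => (C i).toSympCode)
      (fun i => (C i).isAdditiveCode_toSympCode) hk (by norm_num) le_rfl h1

end CSS

/-! ### Lemma 3.2 exactly (`dim N(S)_M + rank H_M = 2|M|`) and the printed correctability criterion -/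

section ExactCount

variable {n : ℕ} (T : Submodule (ZMod 2) (SympVec n))

/-- For vectors supported on `M`, orthogonality to `S̄` is orthogonality to the restriction `ρ_M(S̄)`:
`S̄⊥ ⊓ P(M) = ρ_M(S̄)⊥ ⊓ P(M)` ("the syndrome of an error included in the erasure `ℰ` depends only on these columns").
[cite: DelfosseZemor2013, §3.2 (H_ℰ) and §3.3 proof of Lemma 3.2 (σ_ℰ depends only on H_ℰ)] -/
theorem sympDual_inf_supportedOn_eq_sympDual_map_proj_inf (M : Finset (Fin n)) :
    (sympDual T ⊓ supportedOn M : Submodule (ZMod 2) (SympVec n)) = sympDual (T.map (proj M)) ⊓ supportedOn M := by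
  ext u
  constructor
  · rintro ⟨hu, huM⟩
    refine ⟨mem_sympDual_iff.2 ?_, huM⟩
    rintro _ ⟨s, hs, rfl⟩
    rw [sympInner_comm (proj M s) u, sympInner_proj_right huM s, sympInner_comm u s]
    exact mem_sympDual_iff.1 hu s hs
  · rintro ⟨hu, huM⟩
    refine ⟨mem_sympDual_iff.2 fun s hs => ?_, huM⟩
    have h := mem_sympDual_iff.1 hu (proj M s) ⟨s, hs, rfl⟩
    rw [sympInner_comm (proj M s) u, sympInner_proj_right huM s, sympInner_comm u s] at h
    exact h

/-- **Lemma 3.2 (Delfosse–Zémor), exactly**: `dim N(S)_M + rank H_M = 2|M|`, where `N(S)_M = S̄⊥ ⊓ P(M)` are the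
zero-syndrome Paulis inside `M` and `rank H_M = dim ρ_M(S̄)` ("The set `N(S)_ℰ` is an 𝔽₂-vector space of dimension
`2|ℰ| − rank H_ℰ`") — the tree's exact cleaning count `finrank_sympDual_inf_supportedOn_add` combined with Lemma 3.3.
[cite: DelfosseZemor2013, §3.3 Lemma 3.2 (chunk p0008 L32–L46)] -/
theorem finrank_sympDual_inf_supportedOn_add_finrank_map_proj (M : Finset (Fin n)) :
    finrank (ZMod 2) ↥(sympDual T ⊓ supportedOn M) + finrank (ZMod 2) ↥(T.map (proj M)) = 2 * M.card := by
  have h1 := finrank_sympDual_inf_supportedOn_add T M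
  have h2 := finrank_map_proj_add_finrank_inf_supportedOn T Mᶜ
  rw [compl_compl] at h2
  omega

/-- **"The erasure `ℰ` can be corrected only if `2|ℰ| ≤ rank H + rank H_ℰ − rank H_ℰ̄`"** (every subspace `S̄`; in the
additive form `2|M| + rank H_{Mᶜ} ≤ rank H + rank H_M`). [cite: DelfosseZemor2013, §3.3 eq. (rank_equation_idea) (chunk p0008 L64–L74)] -/
theorem two_mul_card_add_le_of_isCorrectableRegion {M : Finset (Fin n)} (hM : IsCorrectableRegion T M) :
    2 * M.card + finrank (ZMod 2) ↥(T.map (proj Mᶜ)) ≤ finrank (ZMod 2) T + finrank (ZMod 2) ↥(T.map (proj M)) := by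
  have h1 := finrank_sympDual_inf_supportedOn_add_finrank_map_proj T M
  have h2 := finrank_map_proj_add_finrank_inf_supportedOn T M
  have hle : (sympDual T ⊓ supportedOn M : Submodule (ZMod 2) (SympVec n)) ≤ T ⊓ supportedOn M :=
    fun v hv => ⟨hM v hv.1 hv.2, hv.2⟩
  have h3 : finrank (ZMod 2) ↥(sympDual T ⊓ supportedOn M) ≤ finrank (ZMod 2) ↥(T ⊓ supportedOn M) :=
    Submodule.finrank_mono hle
  omega

/-- **The printed criterion as an equivalence** (self-orthogonal `S̄`): `M` is correctable iff
`2|M| + rank H_{Mᶜ} = rank H + rank H_M`, i.e. `2|M| = rank H + rank H_M − rank H_{M̄}` ("there are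
`2^{rank H + rank H_ℰ − rank H_ℰ̄}` correctable error patterns and `2^{2|ℰ|}` error vectors covered by `ℰ`"); via the
tree's `isCorrectableRegion_iff_finrank_eq`. [cite: DelfosseZemor2013, §3.3 Lemmas 3.2–3.3 and eq. (rank_equation_idea) (chunk p0008 L32–L74)] -/
theorem isCorrectableRegion_iff_rank (hself : IsSelfOrthogonal T) (M : Finset (Fin n)) :
    IsCorrectableRegion T M ↔
      2 * M.card + finrank (ZMod 2) ↥(T.map (proj Mᶜ)) = finrank (ZMod 2) T + finrank (ZMod 2) ↥(T.map (proj M)) := by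
  rw [isCorrectableRegion_iff_finrank_eq hself M]
  have h1 := finrank_sympDual_inf_supportedOn_add_finrank_map_proj T M
  have h2 := finrank_map_proj_add_finrank_inf_supportedOn T M
  omega

end ExactCount

end Literature.InformationTheory.QuantumCodes
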